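import Mathlib

/-!
# The Jacquet recurrence for functionals killed eventually along a contracting element

Pure algebra behind the asymptotic expansion of Kirillov / Whittaker functions of smooth
representations at a finite place (Jacquet–Langlands (1970), §2; Casselman (1995), §3–§4;
Jacquet–Shalika, *Euler products I* (1981), §1): let `ρ` be a representation of `G` on `V`,
`N ≤ G`, `a ∈ G`, and let `Λ_ω : V → k` (`ω ∈ Ω`) be linear functionals such that for every
`n ∈ N`, `w ∈ V` there is `k₀` with `Λ_ω(ρ(a^m)(ρ(n) w - w)) = 0` for all `m ≥ k₀` and ALL `ω`
(for `ψ`-Whittaker functionals this is `(ψ(a^m n a^{-m}) - 1) Λ = 0` once `a^m n a^{-m}` lies in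
the kernel of `ψ`). Then every element of the coinvariant kernel `V(N) = span{ρ(n)w - w}` is
killed eventually (`exists_forall_apply_pow_eq_zero_of_mem_ker`), and if finitely many vectors
`v_i` satisfy `ρ(a) v_i ≡ Σ_l M_{il} v_l (mod V(N))`, the sequences
`F_ω(m) = (Λ_ω(ρ(a^m) v_i))_i` satisfy the **linear recurrence** `F_ω(m+1) = M F_ω(m)` for
`m ≥ K`, with `K` independent of `ω` (`exists_forall_mulVec_eq`), and every `w₀ ≡ Σ c_l v_l`
has `Λ_ω(ρ(a^m) w₀) = c · F_ω(m)` for `m ≥ K'` (`exists_forall_apply_pow_eq_dotProduct`).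
Over a field, such data `(v, M)` are extracted from any finite-dimensional subspace of the
coinvariants stable under the operator induced by `a` and liftable to a given set of vectors
(`exists_lifts_matrix_of_finiteDimensional`). [folklore]
-/

namespace Literature.RepresentationTheory

open Representation

section CommRing

variable {k G V : Type*} [CommRing k] [Group G] [AddCommGroup V] [Module k V]
  (ρ : Representation k G V) (N : Subgroup G) (a : G) {Ω : Type*} (Λ : Ω → V →ₗ[k] k)

/-- **Eventual killing passes to the coinvariant kernel.** If each generator `ρ(n) w - w` of
`V(N)` is killed by all `Λ_ω ∘ ρ(a^m)` for `m` large (uniformly in `ω`), so is every element of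
`V(N)`. [folklore] -/
theorem exists_forall_apply_pow_eq_zero_of_mem_ker
    (hgen : ∀ (n : N) (w : V), ∃ k₀ : ℕ, ∀ m, k₀ ≤ m → ∀ ω, Λ ω (ρ (a ^ m) (ρ n w - w)) = 0)
    {x : V} (hx : x ∈ Coinvariants.ker (ρ.comp N.subtype)) :
    ∃ k₀ : ℕ, ∀ m, k₀ ≤ m → ∀ ω, Λ ω (ρ (a ^ m) x) = 0 := by
  induction hx using Submodule.span_induction with
  | mem x hx =>
    obtain ⟨⟨n, w⟩, rfl⟩ := hx
    exact hgen n w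
  | zero => exact ⟨0, fun m _ ω => by simp⟩
  | add x y _ _ hx hy =>
    obtain ⟨k₁, h₁⟩ := hx
    obtain ⟨k₂, h₂⟩ := hy
    refine ⟨max k₁ k₂, fun m hm ω => ?_⟩
    rw [map_add, map_add, h₁ m (le_of_max_le_left hm) ω, h₂ m (le_of_max_le_right hm) ω,
      add_zero]
  | smul c x _ hx =>
    obtain ⟨k₁, h₁⟩ := hx
    refine ⟨k₁, fun m hm ω => ?_⟩
    rw [map_smul, map_smul, h₁ m hm ω, smul_zero]

/-- **The Jacquet recurrence.** If `ρ(a) v_i - Σ_l M_{il} v_l ∈ V(N)` for `i < r`, then the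
vectors `F_ω(m) = (Λ_ω(ρ(a^m) v_i))_i` satisfy `F_ω(m+1) = M F_ω(m)` for all `m ≥ K`, with `K`
independent of `ω`; hence `F_ω(K + j) = M^j F_ω(K)`. [folklore] -/
theorem exists_forall_mulVec_eq
    (hgen : ∀ (n : N) (w : V), ∃ k₀ : ℕ, ∀ m, k₀ ≤ m → ∀ ω, Λ ω (ρ (a ^ m) (ρ n w - w)) = 0)
    {r : ℕ} (v : Fin r → V) (M : Matrix (Fin r) (Fin r) k)
    (hv : ∀ i, ρ a (v i) - ∑ l, M i l • v l ∈ Coinvariants.ker (ρ.comp N.subtype)) :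
    ∃ K : ℕ, (∀ ω m, K ≤ m →
        (fun i => Λ ω (ρ (a ^ (m + 1)) (v i))) = M.mulVec fun i => Λ ω (ρ (a ^ m) (v i))) ∧
      ∀ ω j, (fun i => Λ ω (ρ (a ^ (K + j)) (v i))) =
        (M ^ j).mulVec fun i => Λ ω (ρ (a ^ K) (v i)) := by
  choose k₀ hk₀ using fun i => exists_forall_apply_pow_eq_zero_of_mem_ker ρ N a Λ hgen (hv i)
  set K : ℕ := Finset.univ.sup k₀ with hK
  have hstep : ∀ ω m, K ≤ m →
      (fun i => Λ ω (ρ (a ^ (m + 1)) (v i))) = M.mulVec fun i => Λ ω (ρ (a ^ m) (v i)) := by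
    intro ω m hm
    funext i
    have hi : k₀ i ≤ m := (Finset.le_sup (Finset.mem_univ i)).trans hm
    have h0 := hk₀ i m hi ω
    have hsplit : ρ (a ^ (m + 1)) (v i) =
        ρ (a ^ m) (ρ a (v i) - ∑ l, M i l • v l) + ρ (a ^ m) (∑ l, M i l • v l) := by
      rw [← map_add, sub_add_cancel, pow_succ, map_mul, Module.End.mul_apply]
    rw [hsplit, map_add, h0, zero_add, map_sum, map_sum]
    simp only [map_smul, smul_eq_mul, Matrix.mulVec, dotProduct]
  refine ⟨K, hstep, fun ω j => ?_⟩
  induction j with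
  | zero => simp
  | succ j ih =>
    rw [pow_succ', ← Matrix.mulVec_mulVec, ← ih, ← add_assoc]
    exact hstep ω (K + j) (Nat.le_add_right K j)

/-- **Observables.** If moreover `w₀ - Σ_l c_l v_l ∈ V(N)`, then
`Λ_ω(ρ(a^m) w₀) = c · F_ω(m)` for all `m ≥ K'`, uniformly in `ω`. [folklore] -/
theorem exists_forall_apply_pow_eq_dotProduct
    (hgen : ∀ (n : N) (w : V), ∃ k₀ : ℕ, ∀ m, k₀ ≤ m → ∀ ω, Λ ω (ρ (a ^ m) (ρ n w - w)) = 0)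
    {r : ℕ} (v : Fin r → V) (c : Fin r → k) {w₀ : V}
    (hw₀ : w₀ - ∑ l, c l • v l ∈ Coinvariants.ker (ρ.comp N.subtype)) :
    ∃ K' : ℕ, ∀ ω m, K' ≤ m →
      Λ ω (ρ (a ^ m) w₀) = c ⬝ᵥ fun i => Λ ω (ρ (a ^ m) (v i)) := by
  obtain ⟨K', hK'⟩ := exists_forall_apply_pow_eq_zero_of_mem_ker ρ N a Λ hgen hw₀
  refine ⟨K', fun ω m hm => ?_⟩
  have hsplit : ρ (a ^ m) w₀ = ρ (a ^ m) (w₀ - ∑ l, c l • v l) + ρ (a ^ m) (∑ l, c l • v l) := by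
    rw [← map_add, sub_add_cancel]
  rw [hsplit, map_add, hK' m hm ω, zero_add, map_sum, map_sum]
  simp only [map_smul, smul_eq_mul, dotProduct]

end CommRing

section Field

variable {k G V : Type*} [Field k] [Group G] [AddCommGroup V] [Module k V]
  (ρ : Representation k G V) (N : Subgroup G) (a : G)

/-- **Extraction of the recurrence data.** Let `Q'` be a finite-dimensional subspace of the
coinvariants `V_N`, stable under a linear operator `T` compatible with `ρ(a)`
(`[ρ(a) x] = T [x]`), all of whose elements lift to a set `S ⊆ V`. Then there are finitely many
`v_i ∈ S` and a matrix `M` with `ρ(a) v_i ≡ Σ_l M_{il} v_l (mod V(N))`, such that every `w₀`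
with `[w₀] ∈ Q'` is `≡ Σ_l c_l v_l` for some `c`. [folklore] -/
theorem exists_lifts_matrix_of_finiteDimensional
    (Q' : Submodule k (Coinvariants (ρ.comp N.subtype))) [FiniteDimensional k Q']
    (T : Coinvariants (ρ.comp N.subtype) →ₗ[k] Coinvariants (ρ.comp N.subtype))
    (hT : ∀ x : V, Coinvariants.mk (ρ.comp N.subtype) (ρ a x) =
      T (Coinvariants.mk (ρ.comp N.subtype) x))
    (hQ'T : ∀ q ∈ Q', T q ∈ Q') (S : Set V)
    (hlift : ∀ q ∈ Q', ∃ x ∈ S, Coinvariants.mk (ρ.comp N.subtype) x = q) :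
    ∃ (r : ℕ) (v : Fin r → V) (M : Matrix (Fin r) (Fin r) k), (∀ i, v i ∈ S) ∧
      (∀ i, ρ a (v i) - ∑ l, M i l • v l ∈ Coinvariants.ker (ρ.comp N.subtype)) ∧
      ∀ w₀ : V, Coinvariants.mk (ρ.comp N.subtype) w₀ ∈ Q' →
        ∃ c : Fin r → k, w₀ - ∑ l, c l • v l ∈ Coinvariants.ker (ρ.comp N.subtype) := by
  set b := Module.finBasis k Q' with hb
  set r := Module.finrank k Q' with hr
  choose v hvS hvb using fun i : Fin r => hlift (b i) (b i).2
  set M : Matrix (Fin r) (Fin r) k := fun i l => b.repr ⟨T (b i), hQ'T _ (b i).2⟩ l with hM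
  have hsum : ∀ (q : Q'), ((q : Q') : Coinvariants (ρ.comp N.subtype)) =
      ∑ l, b.repr q l • Coinvariants.mk (ρ.comp N.subtype) (v l) := by
    intro q
    conv_lhs => rw [← b.sum_repr q]
    rw [Submodule.coe_sum]
    refine Finset.sum_congr rfl fun l _ => ?_
    rw [Submodule.coe_smul, hvb]
  refine ⟨r, v, M, hvS, fun i => ?_, fun w₀ hw₀ => ?_⟩
  · rw [← Coinvariants.mk_eq_iff, hT, hvb, map_sum]
    have := hsum ⟨T (b i), hQ'T _ (b i).2⟩
    simp only at this
    rw [this]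
    refine Finset.sum_congr rfl fun l _ => ?_
    rw [map_smul]
  · set q₀ : Q' := ⟨_, hw₀⟩ with hq₀
    refine ⟨fun l => b.repr q₀ l, ?_⟩
    rw [← Coinvariants.mk_eq_iff, map_sum]
    have h1 : Coinvariants.mk (ρ.comp N.subtype) w₀ = ((q₀ : Q') : Coinvariants (ρ.comp N.subtype)) :=
      rfl
    rw [h1, hsum q₀]
    refine Finset.sum_congr rfl fun l _ => ?_
    rw [map_smul]

end Field

end Literature.RepresentationTheory
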